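import Mathlib
import Summits.AnomalousDissipation.AnomalousDissipation.Theorems.MarginalStabilityChainStretchedVortexRowsStubRowVorticityConstructionToolsDecayA
import Summits.AnomalousDissipation.AnomalousDissipation.Theorems.MarginalStabilityChainStretchedVortexRowsStubRowVorticityConstructionToolsDiv

/-!
# Stub `stub_rowVorticityConstruction` (crux stmt-AnomalousDissipation-3009) — tools XVI:
# the exponential decay package of the cylinder Biot–Savart velocity gradients

Helper file (supports stmt-AnomalousDissipation-3009). For `L > 0` and an `L`-periodic `ω ∈ C²` with Gaussian bounds
on `ω, Dω, D²ω`, the velocity `u = −(2L)⁻¹∫_{S_L}K₁ω(· − q)`, `v = (2L)⁻¹∫_{S_L}K₂ω(· − q)` satisfies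

  `|∂ₓu| + |∂_yu| + |∂ₓv| + |∂_yv| + |∂_y²u| ≤ C₀ e^{−(π/L)|y|}`   (`decay_rowBS`)

— the EXPONENTIAL DECAY PACKAGE of `stub_rowVorticityConstruction` for the reconstructed velocity. Assembly: the
derivatives pass onto `ω` (tools II), `K₁ = tanh + R` with `R, K₂ ∈` the class of tools XIV
(`|·| ≤ (A + D/‖q‖)e^{−2π|q₂|/L}`), the `tanh`-parts vanish (`∂ₓ`) or become `sech²`-convolutions of one derivative
less (`∂_y`, tools XV), every remaining strip convolution decays like `e^{−(π/L)|y|}` (tools XIV), and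
`∂_yv = −∂ₓu` (tools VII). Registered sub-goal proved here: `stub_rowVorticityConstruction_biotSavartDecay`.
All `[folklore]`.
-/

set_option linter.dupNamespace false

noncomputable section

open Real Set Filter Topology MeasureTheory
open Literature.Analysis.FluidPDE Literature.Analysis.FluidPDE.StretchedLayer

namespace Summit.AnomalousDissipation.AnomalousDissipation.Theorems.MarginalStabilityChainStretchedVortexRows.RowBiotSavart

section Decay

variable {L : ℝ} {ω : ℝ → ℝ → ℝ}

/-- The constant of an exponential majorant of an absolute value is nonnegative. [folklore] -/
theorem nonneg_of_abs_le_mul_exp {f : ℝ → ℝ → ℝ} {K c : ℝ} (h : ∀ x y, |f x y| ≤ K * Real.exp (-c * |y|)) : 0 ≤ K := by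
  have := (abs_nonneg _).trans (h 0 0); simpa using this

/-- **Splitting `K₁ = R + tanh` under the strip integral** against a continuous Gaussian-bounded density. [folklore] -/
theorem integral_rowKerU_mul_split (hL : 0 < L) {g : ℝ → ℝ → ℝ} (hg : Continuous fun p : ℝ × ℝ => g p.1 p.2)
    {C a : ℝ} (ha : 0 < a) (hgb : ∀ a' t, |g a' t| ≤ C * Real.exp (-a * t ^ 2)) (x y : ℝ) :
    ∫ q in Ioc (-(L / 2)) (L / 2) ×ˢ (univ : Set ℝ),
        Real.sinh (2 * π * q.2 / L) / (Real.cosh (2 * π * q.2 / L) - Real.cos (2 * π * q.1 / L)) * g (x - q.1) (y - q.2) =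
      (∫ q in Ioc (-(L / 2)) (L / 2) ×ˢ (univ : Set ℝ),
        (Real.sinh (2 * π * q.2 / L) / (Real.cosh (2 * π * q.2 / L) - Real.cos (2 * π * q.1 / L)) -
          Real.sinh (2 * π * q.2 / L) / Real.cosh (2 * π * q.2 / L)) * g (x - q.1) (y - q.2)) +
      ∫ q in Ioc (-(L / 2)) (L / 2) ×ˢ (univ : Set ℝ),
        Real.sinh (2 * π * q.2 / L) / Real.cosh (2 * π * q.2 / L) * g (x - q.1) (y - q.2) := by
  have hC : 0 ≤ C := by have := (abs_nonneg _).trans (hgb 0 0); simpa using this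
  have hgc : Continuous fun q : ℝ × ℝ => g (x - q.1) (y - q.2) :=
    hg.comp ((continuous_const.sub continuous_fst).prodMk (continuous_const.sub continuous_snd))
  have hgb' : ∀ q : ℝ × ℝ, |g (x - q.1) (y - q.2)| ≤ C := fun q => (hgb _ _).trans (by
    have : Real.exp (-a * (y - q.2) ^ 2) ≤ 1 := by rw [Real.exp_le_one_iff]; nlinarith [sq_nonneg (y - q.2)]
    nlinarith)
  have hR := integrable_rowKerU_sub_tanh hL
  have i1 : Integrable (fun q : ℝ × ℝ =>
      (Real.sinh (2 * π * q.2 / L) / (Real.cosh (2 * π * q.2 / L) - Real.cos (2 * π * q.1 / L)) -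
        Real.sinh (2 * π * q.2 / L) / Real.cosh (2 * π * q.2 / L)) * g (x - q.1) (y - q.2))
      ((volume : Measure (ℝ × ℝ)).restrict (Ioc (-(L / 2)) (L / 2) ×ˢ (univ : Set ℝ))) := by
    refine (hR.norm.mul_const C).mono' (hR.aestronglyMeasurable.mul hgc.aestronglyMeasurable)
      (Eventually.of_forall fun q => ?_)
    rw [norm_mul]; exact mul_le_mul_of_nonneg_left (by rw [Real.norm_eq_abs]; exact hgb' q) (norm_nonneg _)
  have mT : Measurable fun q : ℝ × ℝ => Real.sinh (2 * π * q.2 / L) / Real.cosh (2 * π * q.2 / L) := by fun_prop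
  have gtT : ∀ c : ℝ, 0 < c → ∀ y₀ : ℝ, Integrable (fun q : ℝ × ℝ =>
      ‖Real.sinh (2 * π * q.2 / L) / Real.cosh (2 * π * q.2 / L)‖ * Real.exp (-c * (y₀ - q.2) ^ 2))
      ((volume : Measure (ℝ × ℝ)).restrict (Ioc (-(L / 2)) (L / 2) ×ˢ (univ : Set ℝ))) :=
    gaussTestable_of_le mT (A := 1) (B := 0) (D := 0) le_rfl le_rfl fun q _ => by
      rw [abs_div, abs_of_pos (Real.cosh_pos _), Real.abs_sinh, ← Real.cosh_abs]
      have h := (div_le_one (Real.cosh_pos |2 * π * q.2 / L|)).2 (Real.sinh_lt_cosh _).le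
      simpa using h
  have bG : ∀ p : ℝ × ℝ, ‖(fun p : ℝ × ℝ => g p.1 p.2) p‖ ≤ C * Real.exp (-a * p.2 ^ 2) := fun p => by
    rw [Real.norm_eq_abs]; exact hgb p.1 p.2
  have i2 : Integrable (fun q : ℝ × ℝ => Real.sinh (2 * π * q.2 / L) / Real.cosh (2 * π * q.2 / L) *
      g (x - q.1) (y - q.2)) ((volume : Measure (ℝ × ℝ)).restrict (Ioc (-(L / 2)) (L / 2) ×ˢ (univ : Set ℝ))) := by
    have := integrable_ker_smul mT.aestronglyMeasurable gtT hg ha bG (x, y)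
    simpa only [smul_eq_mul, Prod.fst_sub, Prod.snd_sub] using this
  rw [← integral_add i1 i2]
  refine integral_congr_ae (Eventually.of_forall fun q => ?_); ring

/-- Common data for the decay estimates: the first-order Gaussian bounds and the kernel inputs. [folklore] -/
theorem exp_half_le (hL : 0 < L) (y : ℝ) : Real.exp (-(4 * π / L / 2) * |y|) ≤ Real.exp (-(2 * π / L / 2) * |y|) := by
  apply Real.exp_le_exp.2
  have h : 0 ≤ π / L * |y| := by positivity
  have h1 : -(4 * π / L / 2) * |y| = -(2 * π / L / 2) * |y| - π / L * |y| := by ring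
  rw [h1]; linarith

/-- **Decay of `∂ₓu`**: `∃ K, |∂ₓu(x,y)| ≤ K e^{−(π/L)|y|}`. [folklore] -/
theorem decay_dX_u (hL : 0 < L) (hω : ContDiff ℝ 1 fun p : ℝ × ℝ => ω p.1 p.2) {C a C' a' : ℝ} (ha : 0 < a)
    (hb : ∀ x y, |ω x y| ≤ C * Real.exp (-a * y ^ 2)) (ha' : 0 < a')
    (hb' : ∀ p, ‖fderiv ℝ (fun p : ℝ × ℝ => ω p.1 p.2) p‖ ≤ C' * Real.exp (-a' * p.2 ^ 2))
    (hper : ∀ x y, ω (x + L) y = ω x y) :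
    ∃ K : ℝ, ∀ x y : ℝ, |dX (fun a b => -(1 / (2 * L)) * ∫ q in Ioc (-(L / 2)) (L / 2) ×ˢ (univ : Set ℝ),
        Real.sinh (2 * π * q.2 / L) / (Real.cosh (2 * π * q.2 / L) - Real.cos (2 * π * q.1 / L)) *
          ω (a - q.1) (b - q.2)) x y| ≤ K * Real.exp (-(π / L) * |y|) := by
  have bX : ∀ a₀ b, |dX ω a₀ b| ≤ C' * Real.exp (-a' * b ^ 2) := fun a₀ b => abs_dX_le hω hb' a₀ b
  have mR : Measurable fun q : ℝ × ℝ => Real.sinh (2 * π * q.2 / L) / (Real.cosh (2 * π * q.2 / L) -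
      Real.cos (2 * π * q.1 / L)) - Real.sinh (2 * π * q.2 / L) / Real.cosh (2 * π * q.2 / L) := by fun_prop
  obtain ⟨K, hK⟩ := exists_strip_conv_le_exp mR (by norm_num) (by positivity) (by positivity : (0:ℝ) < 2 * π / L)
    (fun q hq => abs_rowKerU_sub_tanh_le hL hq) (continuous_dX hω) ha' bX
  refine ⟨1 / (2 * L) * K, fun x y => ?_⟩
  rw [dX_const_mul, dX_rowConv ((measurable_rowKerU L).aestronglyMeasurable) (gaussTestable_rowKerU hL) hω ha hb ha'
    hb' x y, integral_rowKerU_mul_split hL (continuous_dX hω) ha' bX, integral_tanh_mul_dX_eq_zero hL hω ha' hb' hper,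
    add_zero, abs_mul, abs_neg, abs_of_pos (by positivity : (0:ℝ) < 1 / (2 * L)), mul_assoc]
  refine mul_le_mul_of_nonneg_left ((hK x y).trans (le_of_eq ?_)) (by positivity)
  ring_nf

/-- **Decay of `∂_yw` for `w = −(2L)⁻¹∫K₁ g(· − q)`**, `g ∈ C¹` with Gaussian bounds on `g, Dg` (used with `g = ω` and
`g = ∂_yω`): `∃ K, |∂_y w(x,y)| ≤ K e^{−(π/L)|y|}`. [folklore] -/
theorem decay_dY_conv (hL : 0 < L) {g : ℝ → ℝ → ℝ} (hg : ContDiff ℝ 1 fun p : ℝ × ℝ => g p.1 p.2) {C a C' a' : ℝ}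
    (ha : 0 < a) (hb : ∀ x y, |g x y| ≤ C * Real.exp (-a * y ^ 2)) (ha' : 0 < a')
    (hb' : ∀ p, ‖fderiv ℝ (fun p : ℝ × ℝ => g p.1 p.2) p‖ ≤ C' * Real.exp (-a' * p.2 ^ 2)) :
    ∃ K : ℝ, ∀ x y : ℝ, |dY (fun a b => -(1 / (2 * L)) * ∫ q in Ioc (-(L / 2)) (L / 2) ×ˢ (univ : Set ℝ),
        Real.sinh (2 * π * q.2 / L) / (Real.cosh (2 * π * q.2 / L) - Real.cos (2 * π * q.1 / L)) *
          g (a - q.1) (b - q.2)) x y| ≤ K * Real.exp (-(π / L) * |y|) := by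
  have bY : ∀ a₀ b, |dY g a₀ b| ≤ C' * Real.exp (-a' * b ^ 2) := fun a₀ b => abs_dY_le hg hb' a₀ b
  have mR : Measurable fun q : ℝ × ℝ => Real.sinh (2 * π * q.2 / L) / (Real.cosh (2 * π * q.2 / L) -
      Real.cos (2 * π * q.1 / L)) - Real.sinh (2 * π * q.2 / L) / Real.cosh (2 * π * q.2 / L) := by fun_prop
  have mS : Measurable fun q : ℝ × ℝ => 1 / Real.cosh (2 * π * q.2 / L) ^ 2 := by fun_prop
  have hSb : ∀ q ∈ Ioc (-(L / 2)) (L / 2) ×ˢ (univ : Set ℝ),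
      |1 / Real.cosh (2 * π * q.2 / L) ^ 2| ≤ (4 + 0 / ‖q‖) * Real.exp (-(4 * π / L) * |q.2|) :=
    fun q _ => by rw [abs_of_pos (by positivity), zero_div, add_zero]; exact sech_sq_le hL q.2
  obtain ⟨Kb, hKb⟩ := exists_strip_conv_le_exp mR (by norm_num) (by positivity) (by positivity : (0:ℝ) < 2 * π / L)
    (fun q hq => abs_rowKerU_sub_tanh_le hL hq) (continuous_dY hg) ha' bY
  obtain ⟨Kc, hKc⟩ := exists_strip_conv_le_exp mS (by norm_num) le_rfl (by positivity : (0:ℝ) < 4 * π / L) hSb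
    hg.continuous ha hb
  have hKc0 : 0 ≤ Kc := nonneg_of_abs_le_mul_exp hKc
  refine ⟨1 / (2 * L) * (Kb + 2 * π / L * Kc), fun x y => ?_⟩
  rw [dY_const_mul, dY_rowConv ((measurable_rowKerU L).aestronglyMeasurable) (gaussTestable_rowKerU hL) hg ha hb ha'
    hb' x y, integral_rowKerU_mul_split hL (continuous_dY hg) ha' bY, integral_tanh_mul_dY hL hg ha hb ha' hb',
    abs_mul, abs_neg, abs_of_pos (by positivity : (0:ℝ) < 1 / (2 * L)), mul_assoc]
  refine mul_le_mul_of_nonneg_left ((abs_add_le _ _).trans ?_) (by positivity)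
  have e1 := hKb x y
  have e2 := (hKc x y).trans (mul_le_mul_of_nonneg_left (exp_half_le hL y) hKc0)
  have hπL : -(2 * π / L / 2) * |y| = -(π / L) * |y| := by ring
  rw [hπL] at e1 e2
  rw [abs_mul, abs_of_pos (by positivity : (0:ℝ) < 2 * π / L)]
  nlinarith [mul_le_mul_of_nonneg_left e2 (by positivity : (0:ℝ) ≤ 2 * π / L)]

/-- **Decay of `∂ₓv`**: `∃ K, |∂ₓv(x,y)| ≤ K e^{−(π/L)|y|}`. [folklore] -/
theorem decay_dX_v (hL : 0 < L) (hω : ContDiff ℝ 1 fun p : ℝ × ℝ => ω p.1 p.2) {C a C' a' : ℝ} (ha : 0 < a)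
    (hb : ∀ x y, |ω x y| ≤ C * Real.exp (-a * y ^ 2)) (ha' : 0 < a')
    (hb' : ∀ p, ‖fderiv ℝ (fun p : ℝ × ℝ => ω p.1 p.2) p‖ ≤ C' * Real.exp (-a' * p.2 ^ 2)) :
    ∃ K : ℝ, ∀ x y : ℝ, |dX (fun a b => 1 / (2 * L) * ∫ q in Ioc (-(L / 2)) (L / 2) ×ˢ (univ : Set ℝ),
        Real.sin (2 * π * q.1 / L) / (Real.cosh (2 * π * q.2 / L) - Real.cos (2 * π * q.1 / L)) *
          ω (a - q.1) (b - q.2)) x y| ≤ K * Real.exp (-(π / L) * |y|) := by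
  have bX : ∀ a₀ b, |dX ω a₀ b| ≤ C' * Real.exp (-a' * b ^ 2) := fun a₀ b => abs_dX_le hω hb' a₀ b
  obtain ⟨K, hK⟩ := exists_strip_conv_le_exp (measurable_rowKerV L) (by norm_num) (by positivity)
    (by positivity : (0:ℝ) < 2 * π / L) (fun q hq => abs_rowKerV_le_exp hL hq) (continuous_dX hω) ha' bX
  refine ⟨1 / (2 * L) * K, fun x y => ?_⟩
  rw [dX_const_mul, dX_rowConv ((measurable_rowKerV L).aestronglyMeasurable) (gaussTestable_rowKerV hL) hω ha hb ha'
    hb' x y, abs_mul, abs_of_pos (by positivity : (0:ℝ) < 1 / (2 * L)), mul_assoc]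
  refine mul_le_mul_of_nonneg_left ((hK x y).trans (le_of_eq ?_)) (by positivity)
  ring_nf

/-- **The exponential decay package.** For `L > 0` and an `L`-periodic `ω ∈ C²` with Gaussian bounds on
`ω, Dω, D²ω`: `|∂ₓu| + |∂_yu| + |∂ₓv| + |∂_yv| + |∂_y²u| ≤ C₀ e^{−(π/L)|y|}`. [folklore] -/
theorem decay_rowBS (hL : 0 < L) (hω : ContDiff ℝ 2 fun p : ℝ × ℝ => ω p.1 p.2)
    (hB : ∀ i ≤ 2, ∃ C a : ℝ, 0 < a ∧
      ∀ p, ‖iteratedFDeriv ℝ i (fun p : ℝ × ℝ => ω p.1 p.2) p‖ ≤ C * Real.exp (-a * p.2 ^ 2))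
    (hper : ∀ x y, ω (x + L) y = ω x y) :
    ∃ C₀ : ℝ, ∀ x y : ℝ,
      |dX (fun a b => -(1 / (2 * L)) * ∫ q in Ioc (-(L / 2)) (L / 2) ×ˢ (univ : Set ℝ),
          Real.sinh (2 * π * q.2 / L) / (Real.cosh (2 * π * q.2 / L) - Real.cos (2 * π * q.1 / L)) *
            ω (a - q.1) (b - q.2)) x y| +
      |dY (fun a b => -(1 / (2 * L)) * ∫ q in Ioc (-(L / 2)) (L / 2) ×ˢ (univ : Set ℝ),
          Real.sinh (2 * π * q.2 / L) / (Real.cosh (2 * π * q.2 / L) - Real.cos (2 * π * q.1 / L)) *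
            ω (a - q.1) (b - q.2)) x y| +
      |dX (fun a b => 1 / (2 * L) * ∫ q in Ioc (-(L / 2)) (L / 2) ×ˢ (univ : Set ℝ),
          Real.sin (2 * π * q.1 / L) / (Real.cosh (2 * π * q.2 / L) - Real.cos (2 * π * q.1 / L)) *
            ω (a - q.1) (b - q.2)) x y| +
      |dY (fun a b => 1 / (2 * L) * ∫ q in Ioc (-(L / 2)) (L / 2) ×ˢ (univ : Set ℝ),
          Real.sin (2 * π * q.1 / L) / (Real.cosh (2 * π * q.2 / L) - Real.cos (2 * π * q.1 / L)) *
            ω (a - q.1) (b - q.2)) x y| +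
      |dY (dY (fun a b => -(1 / (2 * L)) * ∫ q in Ioc (-(L / 2)) (L / 2) ×ˢ (univ : Set ℝ),
          Real.sinh (2 * π * q.2 / L) / (Real.cosh (2 * π * q.2 / L) - Real.cos (2 * π * q.1 / L)) *
            ω (a - q.1) (b - q.2))) x y| ≤ C₀ * Real.exp (-(π / L) * |y|) := by
  have hω1 : ContDiff ℝ 1 fun p : ℝ × ℝ => ω p.1 p.2 := hω.of_le one_le_two
  obtain ⟨⟨C, a, ha, hb⟩, ⟨C', a', ha', hb'⟩⟩ := gaussBounds_of_iterated (ω := ω) fun i hi => hB i (hi.trans one_le_two)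
  -- bounds for the field `∂_yω` and its derivative
  have cY : ContDiff ℝ 1 fun p : ℝ × ℝ => dY ω p.1 p.2 := contDiff_one_dY hω
  have bY : ∀ a₀ b, |dY ω a₀ b| ≤ C' * Real.exp (-a' * b ^ 2) := fun a₀ b => abs_dY_le hω1 hb' a₀ b
  have hB2 : ∀ i ≤ 1 + 1, ∃ C a : ℝ, 0 < a ∧
      ∀ p, ‖iteratedFDeriv ℝ i (fun p : ℝ × ℝ => ω p.1 p.2) p‖ ≤ C * Real.exp (-a * p.2 ^ 2) := hB
  obtain ⟨C₄, a₄, ha₄, hb₄⟩ := gaussBound_fderiv_apply (n := 1) hω hB2 ((0:ℝ), (1:ℝ)) 1 le_rfl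
  have nf : ∀ (F : ℝ × ℝ → ℝ) (p : ℝ × ℝ), ‖fderiv ℝ F p‖ = ‖iteratedFDeriv ℝ 1 F p‖ := fun F p => by
    rw [← norm_iteratedFDeriv_fderiv, norm_iteratedFDeriv_zero]
  have bY' : ∀ p, ‖fderiv ℝ (fun p : ℝ × ℝ => dY ω p.1 p.2) p‖ ≤ C₄ * Real.exp (-a₄ * p.2 ^ 2) := fun p => by
    rw [dY_uncurry_eq hω1, nf]; exact hb₄ p
  obtain ⟨K₁, hK₁⟩ := decay_dX_u hL hω1 ha hb ha' hb' hper
  obtain ⟨K₂, hK₂⟩ := decay_dY_conv hL hω1 ha hb ha' hb'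
  obtain ⟨K₃, hK₃⟩ := decay_dX_v hL hω1 ha hb ha' hb'
  obtain ⟨K₅, hK₅⟩ := decay_dY_conv hL cY ha' bY ha₄ bY'
  -- `∂_yu` as the convolution of `∂_yω`, for the fifth term
  have F2 : dY (fun a b => -(1 / (2 * L)) * ∫ q in Ioc (-(L / 2)) (L / 2) ×ˢ (univ : Set ℝ),
      Real.sinh (2 * π * q.2 / L) / (Real.cosh (2 * π * q.2 / L) - Real.cos (2 * π * q.1 / L)) * ω (a - q.1) (b - q.2)) =
      fun a b => -(1 / (2 * L)) * ∫ q in Ioc (-(L / 2)) (L / 2) ×ˢ (univ : Set ℝ),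
        Real.sinh (2 * π * q.2 / L) / (Real.cosh (2 * π * q.2 / L) - Real.cos (2 * π * q.1 / L)) *
          dY ω (a - q.1) (b - q.2) := by
    funext a₀ b₀
    rw [dY_const_mul, dY_rowConv ((measurable_rowKerU L).aestronglyMeasurable) (gaussTestable_rowKerU hL) hω1 ha hb
      ha' hb' a₀ b₀]
  refine ⟨K₁ + K₂ + K₃ + K₁ + K₅, fun x y => ?_⟩
  have e1 := hK₁ x y
  have e2 := hK₂ x y
  have e3 := hK₃ x y
  have e5 := hK₅ x y
  have e4 : |dY (fun a b => 1 / (2 * L) * ∫ q in Ioc (-(L / 2)) (L / 2) ×ˢ (univ : Set ℝ),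
      Real.sin (2 * π * q.1 / L) / (Real.cosh (2 * π * q.2 / L) - Real.cos (2 * π * q.1 / L)) *
        ω (a - q.1) (b - q.2)) x y| ≤ K₁ * Real.exp (-(π / L) * |y|) := by
    have := divFree_rowBS hL hω hB hper x y
    rw [show dY (fun a b => 1 / (2 * L) * ∫ q in Ioc (-(L / 2)) (L / 2) ×ˢ (univ : Set ℝ),
      Real.sin (2 * π * q.1 / L) / (Real.cosh (2 * π * q.2 / L) - Real.cos (2 * π * q.1 / L)) *
        ω (a - q.1) (b - q.2)) x y = -dX (fun a b => -(1 / (2 * L)) * ∫ q in Ioc (-(L / 2)) (L / 2) ×ˢ (univ : Set ℝ),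
      Real.sinh (2 * π * q.2 / L) / (Real.cosh (2 * π * q.2 / L) - Real.cos (2 * π * q.1 / L)) *
        ω (a - q.1) (b - q.2)) x y by linarith, abs_neg]
    exact e1
  rw [← F2] at e5
  calc _ ≤ K₁ * Real.exp (-(π / L) * |y|) + K₂ * Real.exp (-(π / L) * |y|) + K₃ * Real.exp (-(π / L) * |y|) +
        K₁ * Real.exp (-(π / L) * |y|) + K₅ * Real.exp (-(π / L) * |y|) :=
        add_le_add (add_le_add (add_le_add (add_le_add e1 e2) e3) e4) e5
    _ = _ := by ring

end Decay

end RowBiotSavart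

open RowBiotSavart in
/-- **Exponential decay of the cylinder Biot–Savart velocity gradients** (registered on stmt-AnomalousDissipation-3009 as
the helper stub `stub_rowVorticityConstruction_biotSavartDecay` of `stub_rowVorticityConstruction`): for `L > 0` and an
`L`-periodic `ω ∈ C²` with Gaussian bounds on `ω, Dω, D²ω`, the velocity `u = −(2L)⁻¹∫_{S_L}K₁ω(· − q)`,
`v = (2L)⁻¹∫_{S_L}K₂ω(· − q)` has `|∂ₓu| + |∂_yu| + |∂ₓv| + |∂_yv| + |∂_y²u| ≤ C₀ e^{−(π/L)|y|}` — the exponential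
decay clause of the stub's conclusion for the reconstructed velocity (`RowBiotSavart.decay_rowBS`). [folklore] -/
theorem stub_rowVorticityConstruction_biotSavartDecay :
    ∀ (L : ℝ) (ω : ℝ → ℝ → ℝ), 0 < L → ContDiff ℝ 2 (fun p : ℝ × ℝ => ω p.1 p.2) →
      (∀ i ≤ 2, ∃ C a : ℝ, 0 < a ∧
        ∀ p : ℝ × ℝ, ‖iteratedFDeriv ℝ i (fun p : ℝ × ℝ => ω p.1 p.2) p‖ ≤ C * Real.exp (-a * p.2 ^ 2)) →
      (∀ x y, ω (x + L) y = ω x y) →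
      ∃ C₀ : ℝ, ∀ x y : ℝ,
        |dX (fun a b => -(1 / (2 * L)) * ∫ q in Set.Ioc (-(L / 2)) (L / 2) ×ˢ (Set.univ : Set ℝ),
            Real.sinh (2 * Real.pi * q.2 / L) / (Real.cosh (2 * Real.pi * q.2 / L) - Real.cos (2 * Real.pi * q.1 / L)) *
              ω (a - q.1) (b - q.2)) x y| +
        |dY (fun a b => -(1 / (2 * L)) * ∫ q in Set.Ioc (-(L / 2)) (L / 2) ×ˢ (Set.univ : Set ℝ),
            Real.sinh (2 * Real.pi * q.2 / L) / (Real.cosh (2 * Real.pi * q.2 / L) - Real.cos (2 * Real.pi * q.1 / L)) *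
              ω (a - q.1) (b - q.2)) x y| +
        |dX (fun a b => 1 / (2 * L) * ∫ q in Set.Ioc (-(L / 2)) (L / 2) ×ˢ (Set.univ : Set ℝ),
            Real.sin (2 * Real.pi * q.1 / L) / (Real.cosh (2 * Real.pi * q.2 / L) - Real.cos (2 * Real.pi * q.1 / L)) *
              ω (a - q.1) (b - q.2)) x y| +
        |dY (fun a b => 1 / (2 * L) * ∫ q in Set.Ioc (-(L / 2)) (L / 2) ×ˢ (Set.univ : Set ℝ),
            Real.sin (2 * Real.pi * q.1 / L) / (Real.cosh (2 * Real.pi * q.2 / L) - Real.cos (2 * Real.pi * q.1 / L)) *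
              ω (a - q.1) (b - q.2)) x y| +
        |dY (dY (fun a b => -(1 / (2 * L)) * ∫ q in Set.Ioc (-(L / 2)) (L / 2) ×ˢ (Set.univ : Set ℝ),
            Real.sinh (2 * Real.pi * q.2 / L) / (Real.cosh (2 * Real.pi * q.2 / L) - Real.cos (2 * Real.pi * q.1 / L)) *
              ω (a - q.1) (b - q.2))) x y| ≤ C₀ * Real.exp (-(Real.pi / L) * |y|) :=
  fun _ _ hL hω hB hper => decay_rowBS hL hω hB hper

end Summit.AnomalousDissipation.AnomalousDissipation.Theorems.MarginalStabilityChainStretchedVortexRows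

end
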